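import Mathlib
import HarnessLib

/-!
# Hardy's inequality, dual (Copson) form, `L²` case: the tail-averaging operator on `(a, ∞)`

Topic `Analysis/FunctionSpaces` (support file: theorems only, no definitions, no named facts).
RH-FREE classical real analysis. For `a > 0` and a non-negative measurable `f ∈ L²(a,∞)` put
`(Pf)(t) = ∫_t^∞ f(u) du/u`. Then `Pf` is square-integrable on `(a,∞)` and
`∫ₐ^∞ (Pf)(t)² dt ≤ 4 ∫ₐ^∞ f²` — Hardy's inequality in the dual form (Hardy–Littlewood–Pólya,
Thm. 328 with `p = 2`, `r = 0`; the integral analogue (6) of "Hardy's Inequality" in Bullen's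
*Dictionary of Inequalities*, `∫₀^∞ (∫ₓ^∞ g)ᵖ dx ≤ pᵖ ∫₀^∞ xᵖ gᵖ`, with `g(u) = f(u)/u`, `p = 2`;
the discrete form is Copson's inequality). The constant `4` is not claimed to be optimal here.

Proof (weighted Cauchy–Schwarz and Tonelli, no integration by parts): for `t ≥ a`,
`(∫_t^∞ f/u)² = (∫_t^∞ (f u^{−1/4})·u^{−3/4})² ≤ (∫_t^∞ f² u^{−1/2}) · (∫_t^∞ u^{−3/2}) = 2t^{−1/2} ∫_t^∞ f²u^{−1/2}`,
and `∫ₐ^∞ 2t^{−1/2} ∫_t^∞ f(u)²u^{−1/2} du dt = ∫ₐ^∞ f(u)² u^{−1/2} (∫ₐ^u 2t^{−1/2} dt) du ≤ ∫ₐ^∞ f(u)² u^{−1/2}·4u^{1/2} du = 4∫ₐ^∞ f²`.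

Consumer: the `t`-side of Burnol's factor `s/(s−1)` in "`ℂ·𝟙_{(0,a)} + L²(a,∞; dt) ≅ (s/(s−1))A^s ℍ²`"
(`Literature/NumberTheory/LFunctions/BurnolZetaSystemsHardy.lean`, Burnol 2004b §4, TeX l.638–643):
`f ↦ f − Pf` realises the factor `s/(s−1)` on right Mellin transforms, and this file is what makes
`Pf ∈ L²(a,∞)`.

## References

* G. H. Hardy, J. E. Littlewood, G. Pólya, *Inequalities*, 2nd ed., Cambridge 1952, §9.9, Thm. 328
  (pp. 239–249). [key `HardyLittlewoodPolya1952`]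
* P. S. Bullen, *A Dictionary of Inequalities*, Chapman & Hall/CRC (1998), "Hardy's Inequality",
  Integral analogues (5)–(6) (held copy, chunk p0087) and "Copson's Inequality" (chunk p0055).
-/

noncomputable section

open MeasureTheory Set Filter
open scoped ENNReal Topology

namespace Literature.Analysis.FunctionSpaces

namespace HardyTail

/-- `∫_t^∞ u^{−3/2} du = 2 t^{−1/2}` for `t > 0`. [folklore] -/
private theorem integral_Ioi_rpow_neg_three_halves {t : ℝ} (ht : 0 < t) :
    ∫ u in Ioi t, u ^ (-(3 / 2 : ℝ)) = 2 * t ^ (-(1 / 2 : ℝ)) := by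
  rw [integral_Ioi_rpow_of_lt (by norm_num) ht, show (-(3 / 2 : ℝ) + 1) = -(1 / 2) by norm_num]
  ring

/-- `(u^{−3/4})² = u^{−3/2}`, `(f u^{−1/4})² = f² u^{−1/2}`, `f u^{−1/4} u^{−3/4} = f/u` (`u > 0`). [folklore] -/
private theorem rpow_aux {u : ℝ} (hu : 0 < u) (x : ℝ) :
    (u ^ (-(3 / 4 : ℝ))) ^ 2 = u ^ (-(3 / 2 : ℝ)) ∧
      (x * u ^ (-(1 / 4 : ℝ))) ^ 2 = x ^ 2 * u ^ (-(1 / 2 : ℝ)) ∧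
      x * u ^ (-(1 / 4 : ℝ)) * u ^ (-(3 / 4 : ℝ)) = x / u := by
  refine ⟨?_, ?_, ?_⟩
  · rw [← Real.rpow_natCast, ← Real.rpow_mul hu.le]; norm_num
  · rw [mul_pow, ← Real.rpow_natCast (u ^ (-(1 / 4 : ℝ))), ← Real.rpow_mul hu.le]; norm_num
  · rw [mul_assoc, ← Real.rpow_add hu, show (-(1 / 4 : ℝ) + -(3 / 4)) = -1 by norm_num,
      Real.rpow_neg_one, div_eq_mul_inv]

/-- **Pointwise weighted Cauchy–Schwarz**: for `0 < a ≤ t`, a non-negative measurable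
`f ∈ L²(a,∞)`: `u ↦ f(u)/u` and `u ↦ f(u)²u^{−1/2}` are integrable on `(t,∞)` and
`(∫_t^∞ f/u)² ≤ 2t^{−1/2} ∫_t^∞ f(u)² u^{−1/2} du`. [cite: HardyLittlewoodPolya1952, Thm. 328 (proof)] -/
theorem sq_integral_div_le {f : ℝ → ℝ} {a : ℝ} (ha : 0 < a) (hfm : Measurable f)
    (hf0 : ∀ u, 0 ≤ f u) (hf : MemLp f 2 (volume.restrict (Ioi a))) {t : ℝ} (ht : a ≤ t) :
    IntegrableOn (fun u ↦ f u / u) (Ioi t) ∧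
      IntegrableOn (fun u ↦ f u ^ 2 * u ^ (-(1 / 2 : ℝ))) (Ioi t) ∧
      (∫ u in Ioi t, f u / u) ^ 2 ≤
        2 * t ^ (-(1 / 2 : ℝ)) * ∫ u in Ioi t, f u ^ 2 * u ^ (-(1 / 2 : ℝ)) := by
  have ht0 : 0 < t := lt_of_lt_of_le ha ht
  have hft : MemLp f 2 (volume.restrict (Ioi t)) :=
    hf.mono_measure (Measure.restrict_mono (Ioi_subset_Ioi ht) le_rfl)
  have hu : ∀ᵐ u ∂(volume.restrict (Ioi t)), u ∈ Ioi t := ae_restrict_mem measurableSet_Ioi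
  -- the weights `w₁ = f u^{−1/4}`, `w₂ = u^{−3/4}`
  set w₁ : ℝ → ℝ := fun u ↦ f u * u ^ (-(1 / 4 : ℝ)) with hw₁def
  set w₂ : ℝ → ℝ := fun u ↦ u ^ (-(3 / 4 : ℝ)) with hw₂def
  have hw₁m : Measurable w₁ := hfm.mul (measurable_id.pow_const _)
  have hw₂m : Measurable w₂ := measurable_id.pow_const _
  have h2 : ENNReal.ofReal (2 : ℝ) = 2 := by norm_num
  -- `w₂² = u^{−3/2}` is integrable on `(t,∞)`
  have hw₂sq : IntegrableOn (fun u : ℝ ↦ u ^ (-(3 / 2 : ℝ))) (Ioi t) :=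
    integrableOn_Ioi_rpow_of_lt (by norm_num) ht0
  have hw₂ : MemLp w₂ 2 (volume.restrict (Ioi t)) := by
    refine (memLp_two_iff_integrable_sq hw₂m.aestronglyMeasurable).2 ?_
    refine hw₂sq.congr_fun (fun u hu' ↦ ?_) measurableSet_Ioi
    exact ((rpow_aux (ht0.trans hu') 0).1).symm
  -- `w₁² = f² u^{−1/2} ≤ t^{−1/2} f²` is integrable on `(t,∞)`
  have hf2 : Integrable (fun u ↦ f u ^ 2) (volume.restrict (Ioi t)) :=
    (memLp_two_iff_integrable_sq hft.1).1 hft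
  have hw₁sq : IntegrableOn (fun u ↦ f u ^ 2 * u ^ (-(1 / 2 : ℝ))) (Ioi t) := by
    refine (hf2.mul_const (t ^ (-(1 / 2 : ℝ)))).mono' ?_ ?_
    · exact ((hfm.pow_const 2).mul (measurable_id.pow_const _)).aestronglyMeasurable
    · filter_upwards [hu] with u hu'
      have hu0 : 0 < u := ht0.trans hu'
      rw [Real.norm_eq_abs, abs_of_nonneg (mul_nonneg (sq_nonneg _) (Real.rpow_nonneg hu0.le _))]
      refine mul_le_mul_of_nonneg_left ?_ (sq_nonneg _)
      exact Real.rpow_le_rpow_of_nonpos ht0 (le_of_lt hu') (by norm_num)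
  have hw₁ : MemLp w₁ 2 (volume.restrict (Ioi t)) := by
    refine (memLp_two_iff_integrable_sq hw₁m.aestronglyMeasurable).2 ?_
    refine hw₁sq.congr_fun (fun u hu' ↦ ?_) measurableSet_Ioi
    exact ((rpow_aux (ht0.trans hu') (f u)).2.1).symm
  -- `f/u = w₁ w₂` on `(t, ∞)`
  have hprod : EqOn (fun u ↦ w₁ u * w₂ u) (fun u ↦ f u / u) (Ioi t) :=
    fun u hu' ↦ (rpow_aux (ht0.trans hu') (f u)).2.2
  have hint_prod : IntegrableOn (fun u ↦ w₁ u * w₂ u) (Ioi t) := hw₁.integrable_mul hw₂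
  have hint_div : IntegrableOn (fun u ↦ f u / u) (Ioi t) :=
    hint_prod.congr_fun hprod measurableSet_Ioi
  refine ⟨hint_div, hw₁sq, ?_⟩
  -- Hölder with `p = q = 2`
  have hH := integral_mul_le_Lp_mul_Lq_of_nonneg (μ := volume.restrict (Ioi t))
    Real.HolderConjugate.two_two
    (show 0 ≤ᵐ[volume.restrict (Ioi t)] w₁ from by
      filter_upwards [hu] with u hu'
      exact mul_nonneg (hf0 u) (Real.rpow_nonneg (ht0.trans hu').le _))
    (show 0 ≤ᵐ[volume.restrict (Ioi t)] w₂ from by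
      filter_upwards [hu] with u hu'
      exact Real.rpow_nonneg (ht0.trans hu').le _)
    (by rw [h2]; exact hw₁) (by rw [h2]; exact hw₂)
  have hA : ∫ u in Ioi t, w₁ u ^ (2 : ℝ) = ∫ u in Ioi t, f u ^ 2 * u ^ (-(1 / 2 : ℝ)) := by
    refine setIntegral_congr_fun measurableSet_Ioi fun u hu' ↦ ?_
    rw [Real.rpow_two]
    exact (rpow_aux (ht0.trans hu') (f u)).2.1
  have hB : ∫ u in Ioi t, w₂ u ^ (2 : ℝ) = 2 * t ^ (-(1 / 2 : ℝ)) := by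
    rw [← integral_Ioi_rpow_neg_three_halves ht0]
    refine setIntegral_congr_fun measurableSet_Ioi fun u hu' ↦ ?_
    rw [Real.rpow_two]
    exact (rpow_aux (ht0.trans hu') (f u)).1
  rw [hA, hB] at hH
  rw [← setIntegral_congr_fun measurableSet_Ioi hprod]
  have hI0 : 0 ≤ ∫ u in Ioi t, w₁ u * w₂ u :=
    setIntegral_nonneg measurableSet_Ioi fun u hu' ↦ mul_nonneg
      (mul_nonneg (hf0 u) (Real.rpow_nonneg (ht0.trans hu').le _))
      (Real.rpow_nonneg (ht0.trans hu').le _)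
  have hA0 : 0 ≤ ∫ u in Ioi t, f u ^ 2 * u ^ (-(1 / 2 : ℝ)) :=
    setIntegral_nonneg measurableSet_Ioi fun u hu' ↦
      mul_nonneg (sq_nonneg _) (Real.rpow_nonneg (ht0.trans hu').le _)
  have hB0 : 0 ≤ 2 * t ^ (-(1 / 2 : ℝ)) := by positivity
  have hsq : (∫ u in Ioi t, w₁ u * w₂ u) * (∫ u in Ioi t, w₁ u * w₂ u) ≤
      ((∫ u in Ioi t, f u ^ 2 * u ^ (-(1 / 2 : ℝ))) ^ (1 / (2 : ℝ)) *
        (2 * t ^ (-(1 / 2 : ℝ))) ^ (1 / (2 : ℝ))) *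
      ((∫ u in Ioi t, f u ^ 2 * u ^ (-(1 / 2 : ℝ))) ^ (1 / (2 : ℝ)) *
        (2 * t ^ (-(1 / 2 : ℝ))) ^ (1 / (2 : ℝ))) :=
    mul_self_le_mul_self hI0 hH
  have hroot : ∀ x : ℝ, 0 ≤ x → x ^ (1 / (2 : ℝ)) * x ^ (1 / (2 : ℝ)) = x := by
    intro x hx
    rw [← Real.rpow_add' hx (by norm_num)]
    norm_num
  calc (∫ u in Ioi t, w₁ u * w₂ u) ^ 2
      = (∫ u in Ioi t, w₁ u * w₂ u) * (∫ u in Ioi t, w₁ u * w₂ u) := sq _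
    _ ≤ _ := hsq
    _ = ((∫ u in Ioi t, f u ^ 2 * u ^ (-(1 / 2 : ℝ))) ^ (1 / (2 : ℝ)) *
          (∫ u in Ioi t, f u ^ 2 * u ^ (-(1 / 2 : ℝ))) ^ (1 / (2 : ℝ))) *
        ((2 * t ^ (-(1 / 2 : ℝ))) ^ (1 / (2 : ℝ)) * (2 * t ^ (-(1 / 2 : ℝ))) ^ (1 / (2 : ℝ))) := by
          ring
    _ = 2 * t ^ (-(1 / 2 : ℝ)) * ∫ u in Ioi t, f u ^ 2 * u ^ (-(1 / 2 : ℝ)) := by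
          rw [hroot _ hA0, hroot _ hB0, mul_comm]

/-- `∫ₐ^u 2 t^{−1/2} dt = 4(u^{1/2} − a^{1/2}) ≤ 4 u^{1/2}` in `lintegral` form: for `0 < a` and any
`u`, `∫⁻_{t ∈ (a,∞), t < u} 2t^{−1/2} ≤ 4 u^{1/2}` (as extended non-negative reals). [folklore] -/
private theorem lintegral_kernel_le {a : ℝ} (ha : 0 < a) {u : ℝ} (hu : a < u) :
    ∫⁻ t in Ioi a, (Iio u).indicator (fun t : ℝ ↦ ENNReal.ofReal (2 * t ^ (-(1 / 2 : ℝ)))) t ≤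
      ENNReal.ofReal (4 * u ^ (1 / 2 : ℝ)) := by
  have hu0 : 0 < u := ha.trans hu
  rw [lintegral_indicator measurableSet_Iio, Measure.restrict_restrict measurableSet_Iio,
    show Iio u ∩ Ioi a = Ioo a u from by ext t; simp [and_comm]]
  -- the integrand is integrable on `(a, u)` (continuous on `[a, u]`)
  have hcont : ContinuousOn (fun t : ℝ ↦ 2 * t ^ (-(1 / 2 : ℝ))) (Icc a u) := by
    refine ContinuousOn.mul continuousOn_const ?_
    exact ContinuousOn.rpow_const continuousOn_id fun t ht ↦ Or.inl (ne_of_gt (ha.trans_le ht.1))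
  have hint : IntegrableOn (fun t : ℝ ↦ 2 * t ^ (-(1 / 2 : ℝ))) (Ioo a u) :=
    (hcont.integrableOn_Icc).mono_set Ioo_subset_Icc_self
  have hnn : 0 ≤ᵐ[volume.restrict (Ioo a u)] fun t : ℝ ↦ 2 * t ^ (-(1 / 2 : ℝ)) := by
    filter_upwards [ae_restrict_mem (μ := (volume : Measure ℝ)) measurableSet_Ioo] with t ht
    exact mul_nonneg zero_le_two (Real.rpow_nonneg (ha.trans ht.1).le _)
  rw [← ofReal_integral_eq_lintegral_ofReal hint hnn]
  refine ENNReal.ofReal_le_ofReal ?_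
  -- compute the integral
  have hIoo : ∫ t in Ioo a u, 2 * t ^ (-(1 / 2 : ℝ)) = ∫ t in a..u, 2 * t ^ (-(1 / 2 : ℝ)) := by
    rw [intervalIntegral.integral_of_le hu.le, integral_Ioc_eq_integral_Ioo]
  rw [hIoo, intervalIntegral.integral_const_mul, integral_rpow (Or.inl (by norm_num)),
    show (-(1 / 2 : ℝ) + 1) = 1 / 2 by norm_num]
  have ha2 : 0 ≤ a ^ (1 / 2 : ℝ) := Real.rpow_nonneg ha.le _
  have h4 : 2 * ((u ^ (1 / 2 : ℝ) - a ^ (1 / 2 : ℝ)) / (1 / 2)) =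
      4 * u ^ (1 / 2 : ℝ) - 4 * a ^ (1 / 2 : ℝ) := by
    ring
  rw [h4]
  linarith

end HardyTail

open HardyTail in
/-- **Hardy's inequality, dual form, `L²` case.** For `a > 0` and a non-negative measurable `f` with
`f ∈ L²(a, ∞)`, the tail average `(Pf)(t) = ∫_t^∞ f(u) du/u` is square-integrable on `(a,∞)` and
`∫ₐ^∞ (∫_t^∞ f(u) du/u)² dt ≤ 4 ∫ₐ^∞ f²`.
[cite: HardyLittlewoodPolya1952, Thm. 328 (p = 2, r = 0; §9.9, pp. 239–249)] -/
theorem hardy_tail_sq_integral_le {f : ℝ → ℝ} {a : ℝ} (ha : 0 < a) (hfm : Measurable f)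
    (hf0 : ∀ u, 0 ≤ f u) (hf : MemLp f 2 (volume.restrict (Ioi a))) :
    IntegrableOn (fun t ↦ (∫ u in Ioi t, f u / u) ^ 2) (Ioi a) ∧
      ∫ t in Ioi a, (∫ u in Ioi t, f u / u) ^ 2 ≤ 4 * ∫ u in Ioi a, f u ^ 2 := by
  -- notation: `g(u) = f(u)² u^{−1/2}` and the kernel `K(t,u) = 1_{t<u} 2t^{−1/2} · g(u)`
  set g : ℝ → ℝ := fun u ↦ f u ^ 2 * u ^ (-(1 / 2 : ℝ)) with hgdef
  have hgm : Measurable g := (hfm.pow_const 2).mul (measurable_id.pow_const _)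
  have hf2 : Integrable (fun u ↦ f u ^ 2) (volume.restrict (Ioi a)) :=
    (memLp_two_iff_integrable_sq hf.1).1 hf
  have hta : ∀ᵐ t ∂(volume.restrict (Ioi a)), t ∈ Ioi a := ae_restrict_mem measurableSet_Ioi
  set K : ℝ → ℝ → ℝ≥0∞ := fun t u ↦
    (if t < u then ENNReal.ofReal (2 * t ^ (-(1 / 2 : ℝ))) else 0) * ENNReal.ofReal (g u) with hKdef
  have hKm : Measurable (Function.uncurry K) := by
    refine Measurable.mul ?_ ((hgm.comp measurable_snd).ennreal_ofReal)
    refine Measurable.ite (measurableSet_lt measurable_fst measurable_snd) ?_ measurable_const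
    exact ((measurable_fst.pow_const _).const_mul 2).ennreal_ofReal
  -- (1) the tail average is measurable in `t`
  have hPm : StronglyMeasurable (fun t : ℝ ↦ ∫ u in Ioi t, f u / u) := by
    have hG : StronglyMeasurable (Function.uncurry fun (t u : ℝ) ↦ if t < u then f u / u else 0) := by
      refine Measurable.stronglyMeasurable ?_
      refine Measurable.ite (measurableSet_lt measurable_fst measurable_snd) ?_ measurable_const
      exact (hfm.comp measurable_snd).div measurable_snd
    have h := hG.integral_prod_right (ν := (volume : Measure ℝ))
    have hfun : (fun t : ℝ ↦ ∫ u in Ioi t, f u / u) =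
        fun t ↦ ∫ u, (fun (t u : ℝ) ↦ if t < u then f u / u else 0) t u := by
      funext t
      rw [← integral_indicator measurableSet_Ioi]
      congr 1
    rw [hfun]
    exact h
  -- (2) the pointwise bound, (3) rewritten as an inner `lintegral` of the kernel
  have hpt : ∀ t ∈ Ioi a, (∫ u in Ioi t, f u / u) ^ 2 ≤ 2 * t ^ (-(1 / 2 : ℝ)) * ∫ u in Ioi t, g u :=
    fun t ht ↦ (sq_integral_div_le ha hfm hf0 hf (le_of_lt ht)).2.2
  have hstep : ∀ t ∈ Ioi a,
      ENNReal.ofReal (2 * t ^ (-(1 / 2 : ℝ)) * ∫ u in Ioi t, g u) = ∫⁻ u in Ioi a, K t u := by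
    intro t ht
    have ht0 : 0 < t := ha.trans ht
    have hc : 0 ≤ 2 * t ^ (-(1 / 2 : ℝ)) := mul_nonneg zero_le_two (Real.rpow_nonneg ht0.le _)
    have hgi : IntegrableOn g (Ioi t) := (sq_integral_div_le ha hfm hf0 hf ht.le).2.1
    have h1 : ∫ u in Ioi t, g u = ∫ u in Ioi a, (Ioi t).indicator g u := by
      rw [setIntegral_indicator measurableSet_Ioi, Ioi_inter_Ioi, max_eq_right ht.le]
    have hgi' : Integrable (fun u ↦ 2 * t ^ (-(1 / 2 : ℝ)) * (Ioi t).indicator g u)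
        (volume.restrict (Ioi a)) := by
      refine Integrable.const_mul ?_ _
      exact (hgi.integrable_indicator measurableSet_Ioi).mono_measure Measure.restrict_le_self
    have hnn' : 0 ≤ᵐ[volume.restrict (Ioi a)] fun u ↦ 2 * t ^ (-(1 / 2 : ℝ)) * (Ioi t).indicator g u := by
      refine ae_of_all _ fun u ↦ mul_nonneg hc ?_
      refine indicator_nonneg (fun u hu ↦ ?_) u
      exact mul_nonneg (sq_nonneg _) (Real.rpow_nonneg (ht0.trans hu).le _)
    rw [h1, ← integral_const_mul, ofReal_integral_eq_lintegral_ofReal hgi' hnn']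
    refine lintegral_congr fun u ↦ ?_
    by_cases htu : t < u
    · rw [indicator_of_mem (show u ∈ Ioi t from htu), hKdef]
      simp only [if_pos htu]
      exact ENNReal.ofReal_mul hc
    · rw [indicator_of_notMem (show u ∉ Ioi t from htu), hKdef]
      simp only [if_neg htu, mul_zero, ENNReal.ofReal_zero, zero_mul]
  -- (4) Tonelli and the kernel bound `∫ₐ^u 2t^{−1/2} dt ≤ 4u^{1/2}`
  have hswap : ∫⁻ t in Ioi a, ∫⁻ u in Ioi a, K t u = ∫⁻ u in Ioi a, ∫⁻ t in Ioi a, K t u :=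
    lintegral_lintegral_swap hKm.aemeasurable
  have hinner : ∀ u ∈ Ioi a, ∫⁻ t in Ioi a, K t u ≤ ENNReal.ofReal (4 * f u ^ 2) := by
    intro u hu
    have hu0 : 0 < u := ha.trans hu
    have hKu : (fun t ↦ K t u) = fun t ↦
        (Iio u).indicator (fun t : ℝ ↦ ENNReal.ofReal (2 * t ^ (-(1 / 2 : ℝ)))) t *
          ENNReal.ofReal (g u) := by
      funext t
      simp only [hKdef, indicator, mem_Iio]
    have hmeas : Measurable fun t : ℝ ↦
        (Iio u).indicator (fun t : ℝ ↦ ENNReal.ofReal (2 * t ^ (-(1 / 2 : ℝ)))) t :=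
      (((measurable_id.pow_const _).const_mul 2).ennreal_ofReal).indicator measurableSet_Iio
    rw [hKu, lintegral_mul_const _ hmeas]
    calc (∫⁻ t in Ioi a, (Iio u).indicator (fun t : ℝ ↦ ENNReal.ofReal (2 * t ^ (-(1 / 2 : ℝ)))) t)
          * ENNReal.ofReal (g u)
        ≤ ENNReal.ofReal (4 * u ^ (1 / 2 : ℝ)) * ENNReal.ofReal (g u) :=
          mul_le_mul' (lintegral_kernel_le ha hu) le_rfl
      _ = ENNReal.ofReal (4 * u ^ (1 / 2 : ℝ) * g u) := (ENNReal.ofReal_mul (by positivity)).symm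
      _ = ENNReal.ofReal (4 * f u ^ 2) := by
          congr 1
          simp only [hgdef]
          have : u ^ (1 / 2 : ℝ) * u ^ (-(1 / 2 : ℝ)) = 1 := by
            rw [← Real.rpow_add hu0]; norm_num
          calc 4 * u ^ (1 / 2 : ℝ) * (f u ^ 2 * u ^ (-(1 / 2 : ℝ)))
              = 4 * f u ^ 2 * (u ^ (1 / 2 : ℝ) * u ^ (-(1 / 2 : ℝ))) := by ring
            _ = 4 * f u ^ 2 := by rw [this, mul_one]
  -- (5) the `lintegral` of `(Pf)²` over `(a,∞)` is at most `4 ∫ₐ^∞ f²`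
  have hM : ∫⁻ t in Ioi a, ENNReal.ofReal ((∫ u in Ioi t, f u / u) ^ 2) ≤
      ENNReal.ofReal (4 * ∫ u in Ioi a, f u ^ 2) := by
    calc ∫⁻ t in Ioi a, ENNReal.ofReal ((∫ u in Ioi t, f u / u) ^ 2)
        ≤ ∫⁻ t in Ioi a, ∫⁻ u in Ioi a, K t u := by
          refine lintegral_mono_ae ?_
          filter_upwards [hta] with t ht
          rw [← hstep t ht]
          exact ENNReal.ofReal_le_ofReal (hpt t ht)
      _ = ∫⁻ u in Ioi a, ∫⁻ t in Ioi a, K t u := hswap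
      _ ≤ ∫⁻ u in Ioi a, ENNReal.ofReal (4 * f u ^ 2) := by
          refine lintegral_mono_ae ?_
          filter_upwards [hta] with u hu
          exact hinner u hu
      _ = ENNReal.ofReal (∫ u in Ioi a, 4 * f u ^ 2) :=
          (ofReal_integral_eq_lintegral_ofReal (hf2.const_mul 4)
            (ae_of_all _ fun u ↦ by positivity)).symm
      _ = ENNReal.ofReal (4 * ∫ u in Ioi a, f u ^ 2) := by rw [integral_const_mul]
  -- (6) conclusion
  have hnn : 0 ≤ᵐ[volume.restrict (Ioi a)] fun t ↦ (∫ u in Ioi t, f u / u) ^ 2 :=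
    ae_of_all _ fun t ↦ sq_nonneg _
  have hPi : IntegrableOn (fun t ↦ (∫ u in Ioi t, f u / u) ^ 2) (Ioi a) := by
    refine ⟨(hPm.measurable.pow_const 2).aestronglyMeasurable, ?_⟩
    rw [hasFiniteIntegral_iff_ofReal hnn]
    exact lt_of_le_of_lt hM ENNReal.ofReal_lt_top
  refine ⟨hPi, ?_⟩
  have h4 : 0 ≤ 4 * ∫ u in Ioi a, f u ^ 2 :=
    mul_nonneg (by norm_num) (setIntegral_nonneg measurableSet_Ioi fun u _ ↦ sq_nonneg _)
  rw [integral_eq_lintegral_of_nonneg_ae hnn hPi.1]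
  exact ENNReal.toReal_le_of_le_ofReal h4 hM

open HardyTail in
/-- **Hardy's inequality, dual form, for complex (or general normed) values**: for `a > 0` and a
measurable `φ` with `φ ∈ L²(a, ∞)`, the tail average `t ↦ ∫_t^∞ φ(u) du/u` is square-integrable on
`(a,∞)` with `∫ₐ^∞ ‖∫_t^∞ φ(u) du/u‖² dt ≤ 4 ∫ₐ^∞ ‖φ‖²` (apply the real case to `‖φ‖`).
[cite: HardyLittlewoodPolya1952, Thm. 328 (p = 2, r = 0; §9.9, pp. 239–249)] -/
theorem hardy_tail_norm_sq_integral_le {φ : ℝ → ℂ} {a : ℝ} (ha : 0 < a) (hφm : Measurable φ)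
    (hφ : MemLp φ 2 (volume.restrict (Ioi a))) :
    (∀ t, a ≤ t → IntegrableOn (fun u ↦ φ u / u) (Ioi t)) ∧
      IntegrableOn (fun t ↦ ‖∫ u in Ioi t, φ u / u‖ ^ 2) (Ioi a) ∧
      ∫ t in Ioi a, ‖∫ u in Ioi t, φ u / u‖ ^ 2 ≤ 4 * ∫ u in Ioi a, ‖φ u‖ ^ 2 := by
  -- the real case for `f = ‖φ‖`
  have hfm : Measurable fun u ↦ ‖φ u‖ := hφm.norm
  have hf : MemLp (fun u ↦ ‖φ u‖) 2 (volume.restrict (Ioi a)) := hφ.norm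
  obtain ⟨hPi, hP⟩ := hardy_tail_sq_integral_le ha hfm (fun u ↦ norm_nonneg _) hf
  -- integrability of `φ/u` on `(t,∞)` and the pointwise comparison `‖∫φ/u‖ ≤ ∫‖φ‖/u`
  have hnorm_div : ∀ {t u : ℝ}, 0 < t → u ∈ Ioi t → ‖φ u / (u : ℂ)‖ = ‖φ u‖ / u := by
    intro t u ht hu
    rw [norm_div, Complex.norm_real, Real.norm_eq_abs, abs_of_pos (ht.trans hu)]
  have hint : ∀ t, a ≤ t → IntegrableOn (fun u ↦ φ u / u) (Ioi t) := by
    intro t ht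
    have hr := (sq_integral_div_le ha hfm (fun u ↦ norm_nonneg _) hf ht).1
    have ht0 : 0 < t := lt_of_lt_of_le ha ht
    refine hr.mono' (hφm.div (Complex.measurable_ofReal.comp measurable_id)).aestronglyMeasurable ?_
    filter_upwards [ae_restrict_mem (μ := (volume : Measure ℝ)) measurableSet_Ioi] with u hu
    exact le_of_eq (hnorm_div ht0 hu)
  have hle : ∀ t ∈ Ioi a, ‖∫ u in Ioi t, φ u / u‖ ≤ ∫ u in Ioi t, ‖φ u‖ / u := by
    intro t ht
    have ht0 : 0 < t := ha.trans ht
    refine norm_integral_le_of_norm_le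
      (sq_integral_div_le ha hfm (fun u ↦ norm_nonneg _) hf ht.le).1 ?_
    filter_upwards [ae_restrict_mem (μ := (volume : Measure ℝ)) measurableSet_Ioi] with u hu
    exact le_of_eq (hnorm_div ht0 hu)
  have hle2 : ∀ᵐ t ∂(volume.restrict (Ioi a)),
      ‖∫ u in Ioi t, φ u / u‖ ^ 2 ≤ (∫ u in Ioi t, ‖φ u‖ / u) ^ 2 := by
    filter_upwards [ae_restrict_mem (μ := (volume : Measure ℝ)) measurableSet_Ioi] with t ht
    rw [sq, sq]
    exact mul_self_le_mul_self (norm_nonneg _) (hle t ht)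
  -- measurability of `t ↦ ∫_{u>t} φ/u`
  have hPm : StronglyMeasurable (fun t : ℝ ↦ ∫ u in Ioi t, φ u / u) := by
    have hG : StronglyMeasurable (Function.uncurry fun (t u : ℝ) ↦ if t < u then φ u / u else 0) := by
      refine Measurable.stronglyMeasurable ?_
      refine Measurable.ite (measurableSet_lt measurable_fst measurable_snd) ?_ measurable_const
      exact (hφm.comp measurable_snd).div (Complex.measurable_ofReal.comp measurable_snd)
    have h := hG.integral_prod_right (ν := (volume : Measure ℝ))
    have hfun : (fun t : ℝ ↦ ∫ u in Ioi t, φ u / u) =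
        fun t ↦ ∫ u, (fun (t u : ℝ) ↦ if t < u then φ u / u else 0) t u := by
      funext t
      rw [← integral_indicator measurableSet_Ioi]
      congr 1
    rw [hfun]
    exact h
  have hPi' : IntegrableOn (fun t ↦ ‖∫ u in Ioi t, φ u / u‖ ^ 2) (Ioi a) := by
    refine hPi.mono' (hPm.norm.measurable.pow_const 2).aestronglyMeasurable ?_
    filter_upwards [hle2] with t ht
    rw [Real.norm_eq_abs, abs_of_nonneg (sq_nonneg _)]
    exact ht
  refine ⟨hint, hPi', le_trans (integral_mono_ae hPi' hPi hle2) hP⟩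

end Literature.Analysis.FunctionSpaces
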